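import Summits.Schanuel.Schanuel.Theorems.ZilberEacEliminant
import Summits.Schanuel.Schanuel.Theorems.ZilberEacPlaneCurvePolyFibres
import Summits.Schanuel.Schanuel.Theorems.ZilberEacTranscendenceDensityPole
import Summits.Schanuel.Schanuel.Theorems.ZilberEacPuiseuxBranches
import HarnessLib

/-!
# Arbitrary base branches, LXVII: BOUNDED BRANCHES AT INFINITY — Mantova–Masser's question along a
# horizontal asymptote by TRANSCENDENCE, with NO direction condition

HONEST FRAMING.  Cell `pub-schanuel` (Zilber's Exponential-Algebraic Closedness, case ladder;
host summit Schanuel), seat 2, gen 31.  The growth method (files XIX–XXXII, LIV, LXI–LXV) needs a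
branch at infinity of the base curve `C : F(x₀, x₁) = 0` along which BOTH coordinates are
unbounded, and a good direction.  Along a branch with `x₀ → ∞` and `x₁ → θ` FINITE (a horizontal
asymptote; the chart `x₀ = s^{-k}`, `x₁ = Φ(s)` with `Φ` analytic) the second exponential
`y₁ = e^{x₁} → e^θ` neither grows nor decays — but it is an ANALYTIC function `e^{Φ(s)}` of the
place parameter, so THEOREM T (file `TranscendenceDensityPole`) applies once `e^{Φ(s)}` is known to
satisfy no algebraic relation with `x₀ = s^{-k}`.  That transcendence is proved here by
ELIMINATION (file LXVI): a relation `H(x₀, e^{x₁}) = 0` along the branch, together with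
`F(x₀, x₁) = 0`, gives `D(x₁, e^{x₁}) = 0` near `x₁ = θ` for the nonzero eliminant `D`, hence (the
branch is not constant, the function `z ↦ D(z, e^z)` is entire) `D(z, e^z) ≡ 0` on `ℂ` — impossible.
Results:
* **`unprojectedDense_boundedBranch`** — the engine: `F` irreducible of `x₁`-degree `≥ 2`, a
  bounded place `F(s^{-k}, Φ(s)) = 0`, a fibre value `ψ(s)s^L` (`ψ(0) ≠ 0`); every irreducible
  `S` of dimension `≤ 2` containing the germ `(s^{-k}, Φ(s), ψ(s)s^L, e^{Φ(s)})` has Zariski-dense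
  exponential points — NO direction hypothesis;
* **`unprojectedDensityQuestion_planeCurve_polyFibre_boundedPlace`** — `{F = 0, y₀ = R}` for every
  `R` nonzero somewhere on the curve: case ∧ dense;
* **`unprojectedDensityQuestion_planeCurve_polyFibre_of_topRow`** — the bounded place constructed
  by Puiseux at infinity (file LXXII): if some row `f_j`, `j ≥ 1`, has the maximal row degree `N`,
  the top row has a root and the curve has a horizontal asymptote: case ∧ dense for every `R`;
Examples (the conic `x₁² + x₀x₁ + x₀ = 0`, whose unbounded branch has the rational real direction
`x₁ ~ -x₀`) and rational fibres are in file LXVII (b).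
Decided instances of an OPEN question (Mantova–Masser, PLMS 2024 §1 p. 5); EC(3,2) OPEN; NOT
Schanuel's conjecture (neither used nor implied); EAC ⇏ SC.
-/

noncomputable section

open Filter Topology Set Complex Polynomial
open Literature.NumberTheory.Transcendental Literature.ModelTheory.Zilber
open Literature.ModelTheory.ExponentialFields

set_option linter.dupNamespace false

namespace Summit.Schanuel.Schanuel.Theorems

section BoundedBranch

variable (F : ℂ[X][X])

/-! ## Part A. `F` and `H` with `x₀` as the variable over `ℂ[x₁][y₁]` -/

/-- The polynomial `F(x₀, x₁)` rewritten with `x₀` as the variable over `R = ℂ[x₁][y₁]`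
(`x₁ ↦ C X ∈ R`), through its evaluations. [folklore] -/
theorem eval_swapToX1 (F : ℂ[X][X]) (a b c : ℂ) :
    ((F.eval₂ (Polynomial.mapRingHom ((Polynomial.C : ℂ[X] →+* ℂ[X][X]).comp Polynomial.C))
        (Polynomial.C (Polynomial.C (Polynomial.X : ℂ[X]) : ℂ[X][X]))).map
      ((Polynomial.evalRingHom b).comp (Polynomial.mapRingHom (Polynomial.evalRingHom a)))).eval c =
      (F.map (Polynomial.evalRingHom c)).eval a := by
  rw [Polynomial.eval_map, ← Polynomial.coe_eval₂RingHom, Polynomial.hom_eval₂]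
  have h1 : (Polynomial.eval₂RingHom ((Polynomial.evalRingHom b).comp
      (Polynomial.mapRingHom (Polynomial.evalRingHom a))) c).comp
      (Polynomial.mapRingHom ((Polynomial.C : ℂ[X] →+* ℂ[X][X]).comp Polynomial.C)) =
      Polynomial.evalRingHom c := by
    refine Polynomial.ringHom_ext (fun r => ?_) ?_
    · simp
    · simp
  rw [h1]
  simp [Polynomial.eval_map]

/-- The polynomial `H(x₀, y₁)` rewritten with `x₀` as the variable over `R = ℂ[x₁][y₁]`
(`y₁ ↦ X ∈ R`), through its evaluations. [folklore] -/
theorem eval_swapToY1 (H : ℂ[X][X]) (a b c : ℂ) :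
    ((H.eval₂ (Polynomial.mapRingHom ((Polynomial.C : ℂ[X] →+* ℂ[X][X]).comp Polynomial.C))
        (Polynomial.C (Polynomial.X : ℂ[X][X]))).map
      ((Polynomial.evalRingHom b).comp (Polynomial.mapRingHom (Polynomial.evalRingHom a)))).eval c =
      (H.map (Polynomial.evalRingHom c)).eval b := by
  rw [Polynomial.eval_map, ← Polynomial.coe_eval₂RingHom, Polynomial.hom_eval₂]
  have h1 : (Polynomial.eval₂RingHom ((Polynomial.evalRingHom b).comp
      (Polynomial.mapRingHom (Polynomial.evalRingHom a))) c).comp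
      (Polynomial.mapRingHom ((Polynomial.C : ℂ[X] →+* ℂ[X][X]).comp Polynomial.C)) =
      Polynomial.evalRingHom c := by
    refine Polynomial.ringHom_ext (fun r => ?_) ?_
    · simp
    · simp
  rw [h1]
  simp [Polynomial.eval_map]

/-! ## Part B. Transcendence of `e^{x₁}` along a bounded branch -/

/-- **Along a non-horizontal branch, `e^{x₁}` satisfies no algebraic relation with `x₀`.**  `F`
irreducible of `x₁`-degree `≥ 2`, a bounded place `F(s^{-k}, Φ(s)) = 0` (`k ≥ 1`, `Φ` analytic at
`0`): no nonzero `H ∈ ℂ[s][t]` has `H(s^{-k}, e^{Φ(s)}) = 0` for all small `s ≠ 0` (elimination of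
`x₀`, identity theorem for the entire function `z ↦ D(z, e^z)`, transcendence of `exp`).
[folklore] (new in this form) -/
theorem not_eventually_relation_exp_boundedBranch (hFirr : Irreducible F) (hn : 2 ≤ F.natDegree)
    {k : ℕ} (hk : 1 ≤ k) {Φ : ℂ → ℂ} (hΦan : AnalyticAt ℂ Φ 0)
    (hplace : ∀ᶠ s in 𝓝[≠] (0 : ℂ), (F.map (Polynomial.evalRingHom (s ^ k)⁻¹)).eval (Φ s) = 0)
    (H : ℂ[X][X]) (hH : H ≠ 0) :
    ¬ ∀ᶠ u in 𝓝[≠] (0 : ℂ),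
      (H.map (Polynomial.evalRingHom ((fun _ : ℂ => (1 : ℂ)) u * u⁻¹ ^ k))).eval
        (Complex.exp (Φ u)) = 0 := by
  classical
  intro hrel
  -- the eliminant
  obtain ⟨D, hD0, hDvan⟩ := exists_eliminant F H hFirr hn hH _ _ (eval_swapToX1 F) (eval_swapToY1 H)
  -- `D(Φ u, e^{Φ u}) = 0` near `0`
  set gD : ℂ → ℂ := fun z => ∑ j ∈ Finset.range (D.natDegree + 1),
    (D.coeff j).eval z * Complex.exp z ^ j with hgD
  have hgDev : ∀ z, gD z = (D.map (Polynomial.evalRingHom z)).eval (Complex.exp z) := by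
    intro z; rw [hgD, evalPP_eq_sum D z _ (Nat.lt_succ_self _)]
  have hgDan : AnalyticOnNhd ℂ gD Set.univ := by
    intro z _
    rw [hgD]
    refine Finset.analyticAt_fun_sum _ fun j _ => ?_
    exact (analyticAt_polynomial_eval_comp analyticAt_id _).mul (analyticAt_cexp.pow j)
  have hrelD : ∀ᶠ u in 𝓝[≠] (0 : ℂ), gD (Φ u) = 0 := by
    filter_upwards [hplace, hrel, self_mem_nhdsWithin] with u hF hHu (hu : u ≠ 0)
    rw [one_mul, inv_pow] at hHu
    rw [hgDev]
    exact hDvan (Φ u) (Complex.exp (Φ u)) ((u ^ k)⁻¹) hF hHu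
  -- the branch is not horizontal
  set θ : ℂ := Φ 0 with hθ
  have hΦne : ∀ᶠ u in 𝓝[≠] (0 : ℂ), Φ u ≠ θ := by
    rcases (hΦan.sub (analyticAt_const : AnalyticAt ℂ (fun _ : ℂ => θ) 0)).eventually_eq_zero_or_eventually_ne_zero
      with h | h
    · exfalso
      -- `x₁ - θ` would vanish along the place
      have hG : (Polynomial.X - Polynomial.C (Polynomial.C θ) : ℂ[X][X]) = 0 := by
        refine rows_eq_zero_of_eventually_zero_along_place' F hFirr (by omega) _ ?_ hk hplace ?_
        · rw [Polynomial.natDegree_X_sub_C]; omega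
        · filter_upwards [eventually_nhdsWithin_of_eventually_nhds h] with u hu
          simp only [Pi.sub_apply, sub_eq_zero] at hu
          simp [hu]
      exact Polynomial.X_sub_C_ne_zero _ hG
    · filter_upwards [h] with u hu
      simpa [sub_eq_zero] using hu
  have hΦtend : Tendsto Φ (𝓝[≠] (0 : ℂ)) (𝓝[≠] θ) :=
    tendsto_nhdsWithin_iff.2 ⟨(hΦan.continuousAt.tendsto).mono_left nhdsWithin_le_nhds, hΦne⟩
  have hfreq : ∃ᶠ z in 𝓝[≠] θ, gD z = 0 := hΦtend.frequently hrelD.frequently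
  have hzero := hgDan.eqOn_zero_of_preconnected_of_frequently_eq_zero isPreconnected_univ
    (Set.mem_univ θ) hfreq
  obtain ⟨z, hz⟩ := exists_exp_relation_ne_zero D hD0
  apply hz
  rw [← hgDev]
  exact hzero (Set.mem_univ z)

/-! ## Part C. The engine: density along a bounded branch -/

/-- **THEOREM (bounded branches).**  `F ∈ ℂ[x₀][x₁]` irreducible of `x₁`-degree `≥ 2`; a bounded
place at infinity `F(s^{-k}, Φ(s)) = 0` (`k ≥ 1`, `Φ` analytic at `0`); a fibre value
`ψ(s)s^L` with `ψ` analytic, `ψ(0) ≠ 0`.  Every irreducible closed `S ⊆ ℂ² × ℂ²` of dimension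
`≤ 2` containing the germ `(s^{-k}, Φ(s), ψ(s)s^L, e^{Φ(s)})` (small `s ≠ 0`) has Zariski-dense
exponential points — with NO direction condition.  (Exponential points along the germ: file XXXI;
THEOREM T with `x₀ = s^{-k}`, `y₁ = e^{Φ(s)}`; transcendence: Part B.) [cite: MantovaMasser2023,
§1 Further remarks, p. 5 (the question, open in general)] (new) -/
theorem unprojectedDense_boundedBranch {S : Set (Fin 2 ⊕ Fin 2 → ℂ)} (hS : IsIrreducibleClosed ℂ S)
    (hdim : zariskiDim ℂ S ≤ (2 : ℕ)) (hFirr : Irreducible F) (hn : 2 ≤ F.natDegree)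
    {k : ℕ} (hk : 1 ≤ k) {Φ : ℂ → ℂ} (hΦan : AnalyticAt ℂ Φ 0)
    (hplace : ∀ᶠ s in 𝓝[≠] (0 : ℂ), (F.map (Polynomial.evalRingHom (s ^ k)⁻¹)).eval (Φ s) = 0)
    (L : ℤ) {ψ : ℂ → ℂ} (hψan : AnalyticAt ℂ ψ 0) (hψ0 : ψ 0 ≠ 0)
    (hgerm : ∀ᶠ s in 𝓝[≠] (0 : ℂ),
      (Sum.elim ![(s ^ k)⁻¹, Φ s] ![ψ s * s ^ L, Complex.exp (Φ s)] : Fin 2 ⊕ Fin 2 → ℂ) ∈ S) :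
    UnprojectedDense S := by
  classical
  have hk0 : k ≠ 0 := by omega
  obtain ⟨z, hz⟩ := IsAlgClosed.exists_pow_nat_eq (2 * Real.pi * I : ℂ) (by omega : 0 < k)
  obtain ⟨N₀, u, s, -, -, -, -, -, -, -, -, hs0, hs, hexp⟩ := exists_poleFibre_expPoints hk L hψan hψ0 hz
  have hsW : Tendsto s atTop (𝓝[≠] (0 : ℂ)) :=
    tendsto_nhdsWithin_iff.2 ⟨hs, Eventually.of_forall hs0⟩
  obtain ⟨J₀, hJ₀⟩ := Filter.eventually_atTop.1 (hsW.eventually hgerm)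
  set p : ℕ → Fin 2 ⊕ Fin 2 → ℂ := fun m =>
    Sum.elim ![(s (J₀ + m) ^ k)⁻¹, Φ (s (J₀ + m))]
      ![ψ (s (J₀ + m)) * s (J₀ + m) ^ L, Complex.exp (Φ (s (J₀ + m)))] with hp
  have hpS : ∀ m, p m ∈ S := fun m => hJ₀ (J₀ + m) (Nat.le_add_right _ _)
  have hpΓ : ∀ m, p m ∈ expGraph ℂ 2 := by
    intro m
    rw [mem_expGraph_iff]
    intro i
    rw [Literature.ModelTheory.ExponentialFields.ExponentialRing.complex_exp_eq]
    fin_cases i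
    · simp [hp, hexp (J₀ + m)]
    · simp [hp]
  have hsJ : Tendsto (fun m => s (J₀ + m)) atTop (𝓝 0) :=
    hs.comp ((tendsto_add_atTop_nat J₀).congr fun m => by ring)
  have hsJ0 : ∀ m, s (J₀ + m) ≠ 0 := fun m => hs0 _
  have hnorm : Tendsto (fun m => ‖p m (Sum.inl 0)‖) atTop atTop := by
    have h1 : Tendsto (fun m => ‖s (J₀ + m) ^ k‖) atTop (𝓝[>] 0) := by
      refine tendsto_nhdsWithin_iff.2 ⟨?_, Eventually.of_forall fun m => ?_⟩
      · have h0 : Tendsto (fun m => s (J₀ + m) ^ k) atTop (𝓝 0) := by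
          simpa [zero_pow hk0] using hsJ.pow k
        simpa using h0.norm
      · exact norm_pos_iff.2 (pow_ne_zero _ (hsJ0 m))
    have h2 := tendsto_inv_nhdsGT_zero.comp h1
    refine h2.congr fun m => ?_
    simp [hp, norm_inv]
  refine unprojectedDense_of_transcendental_relation_pole hS hdim 0 1 hpS hpΓ hnorm
    (U := fun _ => (1 : ℂ)) (w := fun v => Complex.exp (Φ v)) analyticAt_const hΦan.cexp k
    (μ := fun m => s (J₀ + m)) hsJ0 hsJ (fun m => ?_) (fun m => ?_) ?_
  · simp [hp, inv_pow]
  · simp [hp]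
  · exact not_eventually_relation_exp_boundedBranch F hFirr hn hk hΦan hplace

/-! ## Part D. Polynomial fibres along a bounded branch -/

/-- **Polynomial fibres over an irreducible plane curve with a horizontal asymptote: case ∧
dense, no direction condition.**  `F` irreducible of `x₁`-degree `≥ 2`; a bounded place at
infinity `F(s^{-k}, Φ(s)) = 0`; `R` nonzero somewhere on the curve: `{F = 0, y₀ = R}` is in
Mantova–Masser's case and has Zariski-dense exponential points. [cite: MantovaMasser2023, §1
Further remarks, p. 5 (the question, open in general)] (new) -/
theorem unprojectedDensityQuestion_planeCurve_polyFibre_boundedPlace (hFirr : Irreducible F)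
    (hn : 2 ≤ F.natDegree) {k : ℕ} (hk : 1 ≤ k) {Φ : ℂ → ℂ} (hΦan : AnalyticAt ℂ Φ 0)
    (hplace : ∀ᶠ s in 𝓝[≠] (0 : ℂ), (F.map (Polynomial.evalRingHom (s ^ k)⁻¹)).eval (Φ s) = 0)
    (R : MvPolynomial (Fin 2) ℂ)
    (hR : ∃ x y : ℂ, (F.map (Polynomial.evalRingHom x)).eval y = 0 ∧ MvPolynomial.eval ![x, y] R ≠ 0) :
    MMCaseDimPiOneFree {w : Fin 2 ⊕ Fin 2 → ℂ |
        (F.map (Polynomial.evalRingHom (w (Sum.inl 0)))).eval (w (Sum.inl 1)) = 0 ∧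
        w (Sum.inr 0) = MvPolynomial.eval ![w (Sum.inl 0), w (Sum.inl 1)] R} ∧
      UnprojectedDense {w : Fin 2 ⊕ Fin 2 → ℂ |
        (F.map (Polynomial.evalRingHom (w (Sum.inl 0)))).eval (w (Sum.inl 1)) = 0 ∧
        w (Sum.inr 0) = MvPolynomial.eval ![w (Sum.inl 0), w (Sum.inl 1)] R} := by
  classical
  refine ⟨mmCase_planeCurve_polyFibre F hFirr hn R hR, ?_⟩
  obtain ⟨Φr, hΦr⟩ := exists_rowsEquiv
  set A : MvPolynomial (Fin 2) ℂ := Φr.symm F with hA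
  have hPQ : ∀ x y : ℂ, MvPolynomial.eval ![x, y] A = (F.map (Polynomial.evalRingHom x)).eval y := by
    intro x y
    rw [hΦr, hA, RingEquiv.apply_symm_apply]
  have hirrA : Irreducible A := (irreducible_rows_iff hPQ).2 hFirr
  have hset : {w : Fin 2 ⊕ Fin 2 → ℂ |
      (F.map (Polynomial.evalRingHom (w (Sum.inl 0)))).eval (w (Sum.inl 1)) = 0 ∧
      w (Sum.inr 0) = MvPolynomial.eval ![w (Sum.inl 0), w (Sum.inl 1)] R} =
      {w : Fin 2 ⊕ Fin 2 → ℂ | MvPolynomial.eval ![w (Sum.inl 0), w (Sum.inl 1)] A = 0 ∧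
        w (Sum.inr 0) = MvPolynomial.eval ![w (Sum.inl 0), w (Sum.inl 1)] R} := by
    ext w
    simp only [Set.mem_setOf_eq, hPQ]
  rw [hset]
  have hS := isIrreducibleClosed_curveGraphFibre R hirrA
  have hdim := zariskiDim_curveGraphFibre R hirrA
  have hndvd : ¬ F ∣ Φr R := by
    refine not_dvd_of_exists_eval_ne_zero F ?_
    obtain ⟨x, y, hxy, hne⟩ := hR
    exact ⟨x, y, hxy, by rw [← hΦr]; exact hne⟩
  have hplace' : ∀ᶠ s in 𝓝[≠] (0 : ℂ),
      (F.map (Polynomial.evalRingHom (s ^ k)⁻¹)).eval (Φ s * (s ^ 0)⁻¹) = 0 := by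
    filter_upwards [hplace] with s hs
    rwa [pow_zero, inv_one, mul_one]
  obtain ⟨ψ, L, hψan, hψ0, hf⟩ :=
    exists_rows_place_normalForm F hFirr (by omega) (Φr R) hndvd hk 0 hΦan hplace'
  refine unprojectedDense_boundedBranch F hS (le_of_eq hdim) hFirr hn hk hΦan hplace L hψan hψ0 ?_
  filter_upwards [hplace, hf] with s hs hfs
  rw [pow_zero, inv_one, mul_one] at hfs
  refine ⟨?_, ?_⟩
  · simp only [Sum.elim_inl, Matrix.cons_val_zero, Matrix.cons_val_one]
    rw [hPQ]
    exact hs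
  · simp only [Sum.elim_inr, Sum.elim_inl, Matrix.cons_val_zero, Matrix.cons_val_one]
    rw [hΦr, hfs]

/-- **The bounded place from the top row (Puiseux at infinity, file LXXII).**  `F` irreducible
of `x₁`-degree `≥ 2` with rows of degree `≤ N` and top row `T` (`T_j = [x₀^N] f_j`); if `T` has
a root `θ` — in particular if some row `f_j`, `j ≥ 1`, has degree exactly `N` — the curve has a
branch `x₀ → ∞`, `x₁ → θ`, and for every `R` nonzero somewhere on the curve `{F = 0, y₀ = R}` is
in Mantova–Masser's case and has Zariski-dense exponential points. [cite: MantovaMasser2023, §1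
Further remarks, p. 5 (the question, open in general)] (new) -/
theorem unprojectedDensityQuestion_planeCurve_polyFibre_of_topRowRoot (hFirr : Irreducible F)
    (hn : 2 ≤ F.natDegree) (N : ℕ) (hN : ∀ j, (F.coeff j).natDegree ≤ N) (T : ℂ[X])
    (hT : ∀ j, T.coeff j = (F.coeff j).coeff N) {θ : ℂ} (hT0 : T ≠ 0) (hTθ : T.IsRoot θ)
    (R : MvPolynomial (Fin 2) ℂ)
    (hR : ∃ x y : ℂ, (F.map (Polynomial.evalRingHom x)).eval y = 0 ∧ MvPolynomial.eval ![x, y] R ≠ 0) :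
    MMCaseDimPiOneFree {w : Fin 2 ⊕ Fin 2 → ℂ |
        (F.map (Polynomial.evalRingHom (w (Sum.inl 0)))).eval (w (Sum.inl 1)) = 0 ∧
        w (Sum.inr 0) = MvPolynomial.eval ![w (Sum.inl 0), w (Sum.inl 1)] R} ∧
      UnprojectedDense {w : Fin 2 ⊕ Fin 2 → ℂ |
        (F.map (Polynomial.evalRingHom (w (Sum.inl 0)))).eval (w (Sum.inl 1)) = 0 ∧
        w (Sum.inr 0) = MvPolynomial.eval ![w (Sum.inl 0), w (Sum.inl 1)] R} := by
  obtain ⟨k, Φ, hk, hΦan, -, hplace⟩ :=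
    exists_fibreCycle_puiseux F hFirr (by omega) N hN T hT hT0 hTθ
  exact unprojectedDensityQuestion_planeCurve_polyFibre_boundedPlace F hFirr hn hk hΦan hplace R hR

/-- **Row-degree criterion for a horizontal asymptote.**  If the rows have degree `≤ N` and some
row `f_j` with `j ≥ 1` has `[x₀^N] f_j ≠ 0`, the top row has positive degree, hence a root: case ∧
dense for every `R` nonzero somewhere on the curve (`F` irreducible of `x₁`-degree `≥ 2`).
[cite: MantovaMasser2023, §1 Further remarks, p. 5 (the question, open in general)] (new) -/
theorem unprojectedDensityQuestion_planeCurve_polyFibre_of_topRow (hFirr : Irreducible F)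
    (hn : 2 ≤ F.natDegree) (N : ℕ) (hN : ∀ j, (F.coeff j).natDegree ≤ N)
    (hj : ∃ j, 1 ≤ j ∧ (F.coeff j).coeff N ≠ 0) (R : MvPolynomial (Fin 2) ℂ)
    (hR : ∃ x y : ℂ, (F.map (Polynomial.evalRingHom x)).eval y = 0 ∧ MvPolynomial.eval ![x, y] R ≠ 0) :
    MMCaseDimPiOneFree {w : Fin 2 ⊕ Fin 2 → ℂ |
        (F.map (Polynomial.evalRingHom (w (Sum.inl 0)))).eval (w (Sum.inl 1)) = 0 ∧
        w (Sum.inr 0) = MvPolynomial.eval ![w (Sum.inl 0), w (Sum.inl 1)] R} ∧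
      UnprojectedDense {w : Fin 2 ⊕ Fin 2 → ℂ |
        (F.map (Polynomial.evalRingHom (w (Sum.inl 0)))).eval (w (Sum.inl 1)) = 0 ∧
        w (Sum.inr 0) = MvPolynomial.eval ![w (Sum.inl 0), w (Sum.inl 1)] R} := by
  classical
  set T : ℂ[X] := ∑ j ∈ Finset.range (F.natDegree + 1), Polynomial.monomial j ((F.coeff j).coeff N)
    with hTdef
  have hT : ∀ j, T.coeff j = (F.coeff j).coeff N := by
    intro j
    rw [hTdef, Polynomial.finsetSum_coeff]
    simp only [Polynomial.coeff_monomial, Finset.sum_ite_eq', Finset.mem_range]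
    split_ifs with h
    · rfl
    · rw [Polynomial.coeff_eq_zero_of_natDegree_lt (p := F) (by omega), Polynomial.coeff_zero]
  obtain ⟨j, hj1, hjN⟩ := hj
  have hTj : T.coeff j ≠ 0 := by rw [hT]; exact hjN
  have hT0 : T ≠ 0 := fun h => hTj (by rw [h, Polynomial.coeff_zero])
  have hTdeg : T.degree ≠ 0 := by
    intro h0
    have hle := Polynomial.le_natDegree_of_ne_zero hTj
    rw [Polynomial.degree_eq_natDegree hT0] at h0
    have h00 : T.natDegree = 0 := by exact_mod_cast h0
    rw [h00] at hle
    omega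
  obtain ⟨θ, hθ⟩ := IsAlgClosed.exists_root T hTdeg
  exact unprojectedDensityQuestion_planeCurve_polyFibre_of_topRowRoot F hFirr hn N hN T hT hT0 hθ R hR

end BoundedBranch

end Summit.Schanuel.Schanuel.Theorems

end
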